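import Summits.CriticalPhenomena.SAWScalingLimit.Theses.SAWDefectDecoherence
import Summits.CriticalPhenomena.SAWScalingLimit.Theses.SAWDevelopingMap
import Summits.CriticalPhenomena.SAWScalingLimit.Theses.SAWResidueField
import Summits.CriticalPhenomena.SAWScalingLimit.Theorems.ObservableToSLE.Negative.TightnessNecessity
import Summits.CriticalPhenomena.SAWScalingLimit.Theorems.SAWDevelopingMapHexTightLawPerturbation
import Summits.CriticalPhenomena.SAWScalingLimit.Theorems.SAWDevelopingMapHexTightTargetTails
import Literature.Probability.Percolation.LoopRotationInvarianceAssembly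
import Literature.Probability.Percolation.CLE6Proofs
import Literature.Probability.RandomPlanarGeometry.ChordalReversibility
import Literature.Probability.RandomPlanarGeometry.DrivingFunctionMeasurable
import Literature.Probability.RandomPlanarGeometry.CaratheodoryHalfPlaneProofs
import HarnessLib

/-!
# Line `reversible-driving` — skeleton r4 for the crux `HexTight` (stmt-CriticalPhenomena-5423)

Crux-strategist (wall-breaker) `planner-cstrat-stmt-CriticalPhenomena-5423-p1-0`, 2026-08-17 (r1);
lead `prover-line-stmt-CriticalPhenomena-5423-c7-0`, 2026-08-17 (r2: boundary-avoidance clause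
`c δ γ ∈ CurveClass.rangeSubset (D.carrier ∪ {a, b})` added to clause (ii) of `TwoSidedDriving` /
`ForwardPair` / `stub_twoSidedDriving` and to the hypothesis of `SheffieldSunTransfer` /
`stub_sheffieldSun`, so that stub 2 is VERBATIM Sheffield–Sun's setting: their approximating curves range
over the class `𝒮` of simple AND boundary-avoiding chords (arXiv:1003.4675 §1.2, "Throughout we will let
`(γ^j)` denote a sequence in `𝒮`", §1.4); the composition is unchanged).
r3 (lead c7, same day): stub 3 LANDED (p137815, imported); stub 2 REPAIRED — Sheffield–Sun's corollary as
printed (journal Cor. 1.8 / arXiv Cor. 1.7, resting on journal Prop. 1.4) is FALSE as typed: a macroscopic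
detour at forward capacity `→ ∞` AND backward capacity `→ ∞` is invisible to both locally-uniform driving
topologies (deterministic counterexample to Prop. 1.4; SLE(8/3)-randomised counterexample to the corollary,
`Lines/reversible-driving-SSgap.md`, `SheffieldSun-GAP.md`); the repaired transfer carries the uniform target
approach hypotheses (M), (M⁻), supplied on the SAW side by TWO NEW STUBS: `stub_noLateReturn` (lattice
estimate: no late excursion from `b` / no late return to `a`, research-grade) and `stub_targetTails`
(provable glue).  Registered stubs r3: `stub_twoSidedDriving`, `stub_sheffieldSun` (repaired),
`stub_noLateReturn`, `stub_targetTails`; composition `HexTight_of : TwoSidedDriving → NoLateReturn →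
TargetTails → SheffieldSunTransfer → LawPerturbation → HexTight` sorry-free.
r4 (lead c7, same day): stub 5 `stub_targetTails` LANDED (p139515, imported and used by name); helper
`twoSided_iff_forwardPair` LANDED (p140027, `Theorems/SAWDevelopingMapHexTightForwardPair.lean`) and the reversal
glue `noLateReturn_of_noLateExcursion` LANDED (p140037, `…NoLateReturnReduction.lean`, W4) — these two modules import
`Theorems/HexConjecture/Negative/Reversal.lean`, which the check farm currently does not rebuild, so this workfile keeps
its own kernel-checked copies (§0 and §4b) instead of importing them; stub 4 RESHAPED to its b-clause alone
(`NoLateExcursion`: no late excursion from the TARGET), the two-clause `NoLateReturn` being DERIVED from it by exact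
lattice reversibility (§4b).  Registered stubs r4: `stub_twoSidedDriving` (research), `stub_sheffieldSun` (repaired
transfer, XL), `stub_noLateReturn` (= `NoLateExcursion`, research-grade lattice estimate; numerics kit j022408:
P[late excursion at (η, ε) = (0.15N, 0.75N)] = 3–4·10⁻⁴ at N = 5, 8, 11, η-slope ≈ 3.4 vs predicted 7/2).
Disprover target recorded: `SheffieldSunProp14` (typed journal Prop. 1.4, KNOWN FALSE).

## Idea (one paragraph)

Every line tried so far proves tightness of the critical hexagonal SAW the Aizenman–Burchard /
Kemppainen–Smirnov way, i.e. by an a-priori multi-traversal estimate for an arc PINNED AT BOTH ENDS — and dies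
there (crux `NOTES.md` §D: exit-summed parafermionic identities vs. two-pinned ratios; no RSW/FKG/BK at `n = 0`;
surgery has no free energy at `x_c`).  This line does not estimate traversals at all.  Sheffield–Sun
(*Strong path convergence from Loewner driving function convergence*, Ann. Probab. 40 (2012) 578–610,
arXiv:1003.4675, **Cor. 1.7**, `κ ≤ 4`): if SIMPLE random chordal curves have forward Loewner driving functions
converging in law to `√κ B` AND their time reversals have backward driving functions converging in law to
`√κ B`, then the curves converge in law for the UNIFORM metric (modulo reparametrisation) — no a-priori
precompactness ("we do not need to know a priori that the laws … have subsequential weak limits with respect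
to the uniform metric", loc. cit. p. 3).  The critical SAW is EXACTLY reversible on the lattice
(`hexSAWLaw_swap` below, = `HexConjecture.Reversal.hexSAWLaw_swap` of p74061: the `x_c^{ℓ}` weight is reversal invariant), so the backward
hypothesis is the forward hypothesis for the reversed family `(D; b, a)`: ONE statement, driving convergence,
delivered by the observable recipe (Lawler–Schramm–Werner 2004 §3 for LERW, Schramm–Sheffield 2005/2009:
martingale observable ⇒ driving convergence, with NO crossing estimate), gives convergence in `CurveClass ℂ`,
and tightness along the mesh follows by the LANDED lattice-window lemma
`ObservableToSLE.Negative.isTightAlongMesh_of_convergesInLawToSLE` (p-landed, `TightnessNecessity.lean`).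
`HexTight` thereby stops being an independent a-priori estimate for every route that has an observable.

## Registered stubs

* `stub_twoSidedDriving` (RESEARCH, hardest; = what an observable/martingale recipe outputs): for every
  Dobrushin domain, hexagonal endpoint approximation and chordal uniformizers `φ` of `(D; a, b)`, `φ'` of
  `(D; b, a)`, there is a STRAIGHTENING `c_δ` of the SAW curve classes (o(1)-close in probability; eventually
  surely simple, Loewner-describable forward through `φ` and backward through `φ'`) whose forward AND backward
  capacity-parametrised driving paths converge in law, along `δ → 0⁺`, to `√(8/3)·B` in `C([0,∞), ℝ)`.
  (The straightening absorbs the interior lattice endpoints allowed by `IsEmbEndpointApprox`; the backward half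
  is the forward half for the reversed walk family by `backward_iff_forward_reversed` below — exact
  reversibility, kernel-checked.)
* `stub_sheffieldSun` (PUBLISHED THEOREM, Sheffield–Sun 2012 Cor. 1.7 at `κ = 8/3`, typed for an arbitrary
  family of random curve classes along the mesh filter; XL to formalise, or re-file as a Literature named fact).
* `stub_lawPerturbation` (LANDED p137815): convergence in law to chordal SLE is stable under
  perturbations tending to `0` in probability (portmanteau with bounded Lipschitz test functions).
* `stub_noLateReturn` (r3 two-clause; r4 = `NoLateExcursion`, LATTICE, research-grade) and `stub_targetTails` (r3,
  glue, LANDED p139515): see the r3/r4 notes above and the docstrings of `NoLateExcursion` / `NoLateReturn` /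
  `TargetTails`.

Composition `HexTight_of : TwoSidedDriving → SheffieldSunTransfer → LawPerturbation → HexTight` is sorry-free:
uniformizers exist (`MarkedDomain.exists_isChordalUniformizing_holds`), the laws are eventually probability
measures (`eventually_isProbabilityMeasure_hexSAWLaw`), everything on the SAW space is measurable (`⊤`), and the
last step is `isTightAlongMesh_of_convergesInLawToSLE`.

Disproof used: `Disproof.lean` §2 `hexTight_false_without_endpointLimits` — honoured: the endpoint limits enter
through `IsEmbEndpointApprox` in `stub_twoSidedDriving` (describability from `a` to `b` forces them) and through
`eventually_isProbabilityMeasure_hexSAWLaw`; §5/`MeshFilter.not_isTightAlongMesh_of_tendstoLaw` — honoured: the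
step "convergent ⇒ tight along the uncountable mesh filter" is NOT soft and is taken from the landed lattice proof,
not assumed; no stub is an instance of a landed Negative lemma (`LatticeG2False`, `OutwardDiveFalse`,
`PinnedReturnFalse`, `OneScaleDiveSubcritical` concern traversal/dive statements, absent here).
-/

noncomputable section

open scoped ENNReal NNReal Topology unitInterval
open MeasureTheory Filter Topology Set Metric
open UpperHalfPlane (upperHalfPlaneSet)
open Literature Literature.Probability Literature.Probability.LatticeModels
  Literature.Probability.RandomPlanarGeometry Literature.Probability.RandomPlanarGeometry.SAW
open Summit.CriticalPhenomena.SAWScalingLimit.Theorems.ObservableToSLE.Negative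

namespace Summit.CriticalPhenomena.SAWScalingLimit.Cruxes.HexTight.ReversibleDriving

/-! ## §0 Exact lattice reversibility (self-contained copy of the generic part of
`Theorems/HexConjecture/Negative/Reversal.lean`, p74061 — that module is not imported here because its §3
mentions a decl since dropped from route `SAWDefectDecoherence`; nothing below depends on it) -/

section Generic

variable {V : Type*} {G : SimpleGraph V} {emb : V → ℂ} {Ω : Set ℂ} {δ : ℝ} {a b : V}

/-- Time reversal of a self-avoiding walk of `Ω_δ`: the reversed walk (still self-avoiding). [folklore] -/
def sawReverse (γ : EmbDomainSAW G emb Ω δ a b) : EmbDomainSAW G emb Ω δ b a :=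
  ⟨γ.walk.reverse, γ.isPath.reverse⟩

/-- The underlying walk of the reversed SAW. [folklore] -/
@[simp] theorem walk_sawReverse (γ : EmbDomainSAW G emb Ω δ a b) : (sawReverse γ).walk = γ.walk.reverse := rfl

/-- Time reversal is an involution. [folklore] -/
@[simp] theorem sawReverse_sawReverse (γ : EmbDomainSAW G emb Ω δ a b) :
    sawReverse (sawReverse γ) = γ := by
  obtain ⟨w, hw⟩ := γ
  simp only [sawReverse, SimpleGraph.Walk.reverse_reverse]

/-- Time reversal as an equivalence `SAW(a → b) ≃ SAW(b → a)`. [folklore] -/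
def sawReverseEquiv : EmbDomainSAW G emb Ω δ a b ≃ EmbDomainSAW G emb Ω δ b a where
  toFun := sawReverse
  invFun := sawReverse
  left_inv := sawReverse_sawReverse
  right_inv := sawReverse_sawReverse

@[simp] theorem sawReverseEquiv_apply (γ : EmbDomainSAW G emb Ω δ a b) :
    sawReverseEquiv γ = sawReverse γ := rfl

/-- Time reversal as a measurable equivalence (discrete σ-algebras). [folklore] -/
def sawReverseMeasurableEquiv : EmbDomainSAW G emb Ω δ a b ≃ᵐ EmbDomainSAW G emb Ω δ b a where
  toEquiv := sawReverseEquiv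
  measurable_toFun := EmbDomainSAW.measurable_of_top _
  measurable_invFun := EmbDomainSAW.measurable_of_top _

/-- Reversal preserves the number of visited vertices `ℓ(γ)`. [folklore] -/
@[simp] theorem vertexCount_sawReverse (γ : EmbDomainSAW G emb Ω δ a b) :
    (sawReverse γ).vertexCount = γ.vertexCount := by
  simp [EmbDomainSAW.vertexCount, EmbDomainSAW.length, sawReverse]

/-- The SAW measure evaluated on a set: the sum of the weights `x^{ℓ(γ)}` over the set. [folklore] -/
theorem embWeight_apply (x : ℝ) (T : Set (EmbDomainSAW G emb Ω δ a b)) :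
    embWeight G emb Ω δ x a b T =
      ∑' γ : EmbDomainSAW G emb Ω δ a b, T.indicator (fun γ => ENNReal.ofReal (x ^ γ.vertexCount)) γ := by
  rw [embWeight, Measure.sum_apply _ MeasurableSpace.measurableSet_top]
  refine tsum_congr fun γ => ?_
  rw [Measure.smul_apply, smul_eq_mul, Measure.dirac_apply' _ MeasurableSpace.measurableSet_top]
  by_cases hγ : γ ∈ T
  · simp [hγ]
  · simp [hγ]

/-- **Exact reversal invariance of the fugacity weight** `γ ↦ x^{ℓ(γ)}` (LSW 2004 §3.1). [folklore] -/
theorem map_sawReverse_embWeight (x : ℝ) :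
    (embWeight G emb Ω δ x a b).map sawReverse = embWeight G emb Ω δ x b a := by
  ext T -
  rw [Measure.map_apply (EmbDomainSAW.measurable_of_top _) MeasurableSpace.measurableSet_top,
    embWeight_apply, embWeight_apply]
  rw [← (sawReverseEquiv (G := G) (emb := emb) (Ω := Ω) (δ := δ) (a := a) (b := b)).tsum_eq
    (fun γ' => T.indicator (fun γ' => ENNReal.ofReal (x ^ γ'.vertexCount)) γ')]
  refine tsum_congr fun γ => ?_
  simp only [sawReverseEquiv_apply, Set.indicator, vertexCount_sawReverse]
  rfl

/-- The total weights of `a → b` and `b → a` agree. [folklore] -/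
theorem embWeight_univ_swap (x : ℝ) :
    embWeight G emb Ω δ x b a Set.univ = embWeight G emb Ω δ x a b Set.univ := by
  rw [← map_sawReverse_embWeight x,
    Measure.map_apply (EmbDomainSAW.measurable_of_top _) MeasurableSpace.measurableSet_top,
    Set.preimage_univ]

/-- **Exact reversibility of the law `P_{x,δ}`**. [folklore] -/
theorem map_sawReverse_embLaw (x : ℝ) :
    (embLaw G emb Ω δ x a b).map sawReverse = embLaw G emb Ω δ x b a := by
  rw [embLaw, embLaw, Measure.map_smul, map_sawReverse_embWeight, embWeight_univ_swap]

/-- Integration against the `b → a` law is integration of the reversed observable against the `a → b` law.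
[folklore] -/
theorem integral_embLaw_swap {F : Type*} [NormedAddCommGroup F] [NormedSpace ℝ F] (x : ℝ)
    (f : EmbDomainSAW G emb Ω δ b a → F) :
    ∫ γ, f γ ∂(embLaw G emb Ω δ x b a) = ∫ γ, f (sawReverse γ) ∂(embLaw G emb Ω δ x a b) := by
  rw [← map_sawReverse_embLaw x]
  exact integral_map_equiv (sawReverseMeasurableEquiv (G := G) (emb := emb) (Ω := Ω) (δ := δ)
    (a := a) (b := b)) f

/-- An endpoint approximation of `(D; a, b)`, read backwards, is an endpoint approximation of the swapped
Dobrushin domain `D.swap = (D; b, a)`. [folklore] -/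
theorem isEmbEndpointApprox_swap {D : DobrushinDomain} {a b : ℝ → V} (h : IsEmbEndpointApprox G emb D a b) :
    IsEmbEndpointApprox G emb D.swap b a where
  reachable := h.reachable.mono fun δ hδ => hδ.symm
  tendsto_fst := by
    rw [MarkedDomain.pt_swap_zero]
    exact h.tendsto_snd
  tendsto_snd := by
    rw [MarkedDomain.pt_swap_one]
    exact h.tendsto_fst

end Generic

/-- **Lattice reversibility of the critical hexagonal SAW** (every mesh, every pair of endpoints, junk cases
included): `hexSAWLaw Ω δ v u = (hexSAWLaw Ω δ u v).map sawReverse`. [folklore] -/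
theorem hexSAWLaw_swap (Ω : Set ℂ) (δ : ℝ) (u v : HexVertex) :
    hexSAWLaw Ω δ v u = (hexSAWLaw Ω δ u v).map sawReverse :=
  (map_sawReverse_embLaw _).symm

/-! ## Named statements -/

/-- **TWO-SIDED DRIVING CONVERGENCE of the critical hexagonal SAW** (the research stub, `= stub_twoSidedDriving`).
For every Dobrushin domain `(D; a, b)`, hexagonal endpoint approximation `(a_δ, b_δ)` and chordal uniformizing maps
`φ : ℍ → D` (`0 ↦ a`, `∞ ↦ b`), `φ' : ℍ → D.swap` (`0 ↦ b`, `∞ ↦ a`), there is a straightening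
`c δ : HexDomainSAW Ω δ a_δ b_δ → CurveClass ℂ` of the SAW polylines such that
(i) `dist (c δ γ) γ.curve → 0` in `hexSAWLaw`-probability as `δ → 0⁺`;
(ii) for all small `δ` and every walk `γ`, `c δ γ` is a simple class, describable by the Loewner evolution through
`φ`, and its time reversal is describable through `φ'`;
(iii) the forward driving paths `W_φ(c δ γ) ∈ C([0,∞), ℝ)` converge in law to `√(8/3)·B`;
(iv) the backward driving paths `W_{φ'}(reverse (c δ γ))` converge in law to `√(8/3)·B`. -/
def TwoSidedDriving : Prop :=
  ∀ (D : DobrushinDomain) (a b : ℝ → HexVertex), IsEmbEndpointApprox hexGraph hexCenter D a b →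
    ∀ (φ : ConformalEquiv upperHalfPlaneSet D.carrier) (φ' : ConformalEquiv upperHalfPlaneSet D.swap.carrier),
      D.IsChordalUniformizing φ → D.swap.IsChordalUniformizing φ' →
      ∃ c : (δ : ℝ) → HexDomainSAW D.carrier δ (a δ) (b δ) → CurveClass ℂ,
        (∀ ε : ℝ, 0 < ε →
          Tendsto (fun δ : ℝ => hexSAWLaw D.carrier δ (a δ) (b δ) {γ | ε < dist (c δ γ) γ.curve})
            (𝓝[>] (0 : ℝ)) (𝓝 0)) ∧
        (∀ᶠ δ : ℝ in 𝓝[>] (0 : ℝ), ∀ γ : HexDomainSAW D.carrier δ (a δ) (b δ),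
          c δ γ ∈ CurveClass.simple ∧
            c δ γ ∈ CurveClass.rangeSubset (D.carrier ∪ {D.pt 0, D.pt 1}) ∧
            IsLoewnerDescribable φ (c δ γ) ∧
            IsLoewnerDescribable φ' (CurveClass.reverse (c δ γ))) ∧
        TendstoLaw
          (fun δ (γ : HexDomainSAW D.carrier δ (a δ) (b δ)) =>
            (⟨drivingFunction φ (c δ γ), continuous_drivingFunction φ (c δ γ)⟩ : C(ℝ≥0, ℝ)))
          (fun δ => hexSAWLaw D.carrier δ (a δ) (b δ))
          (fun ω : ℝ≥0 → ℝ =>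
            (⟨sleDriving ((8 : ℝ≥0) / 3) ω, continuous_sleDriving ((8 : ℝ≥0) / 3) ω⟩ : C(ℝ≥0, ℝ)))
          Process.preWienerMeasure ∧
        TendstoLaw
          (fun δ (γ : HexDomainSAW D.carrier δ (a δ) (b δ)) =>
            (⟨drivingFunction φ' (CurveClass.reverse (c δ γ)),
              continuous_drivingFunction φ' (CurveClass.reverse (c δ γ))⟩ : C(ℝ≥0, ℝ)))
          (fun δ => hexSAWLaw D.carrier δ (a δ) (b δ))
          (fun ω : ℝ≥0 → ℝ =>
            (⟨sleDriving ((8 : ℝ≥0) / 3) ω, continuous_sleDriving ((8 : ℝ≥0) / 3) ω⟩ : C(ℝ≥0, ℝ)))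
          Process.preWienerMeasure

/-- **SHEFFIELD–SUN TRANSFER at `κ = 8/3`, REPAIRED FORM** (`= stub_sheffieldSun`, r3).  Let
`X δ : Ωδ δ → CurveClass ℂ` be random curve classes under laws `P δ` that are eventually probability measures,
eventually a.e.-measurable, and eventually surely simple, boundary-avoiding, Loewner-describable through a
chordal uniformizer `φ` of `(D; a, b)` and, reversed, through a chordal uniformizer `φ'` of `(D; b, a)`.
Suppose moreover the UNIFORM TARGET APPROACH (M): for every `ε, p > 0` there is a capacity `T` such that,
eventually in `δ`, with `P δ`-probability `≥ 1 - p` the capacity-parametrised curve stays within `ε` of `b`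
after capacity `T`; and (M⁻): the same for the reversed curves through `φ'`, target `a`.  If the forward
driving paths of `X δ` and the backward driving paths of `reverse (X δ)` both converge in law to `√(8/3)·B`,
then `X δ` converges in law, in `CurveClass ℂ`, to chordal SLE(8/3) in `(D; a, b)`.

r1/r2 typed Sheffield–Sun, Ann. Probab. 40 (2012), Cor. 1.8 (= arXiv:1003.4675 Cor. 1.7) VERBATIM (no (M),
(M⁻)).  That form is FALSE: the deterministic Prop. 1.4 of the journal version ("for a simple limit, `d^R`
and `d^L` convergence suffice"), on which the corollary rests by a one-line proof, has a counterexample — a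
macroscopic detour launched at forward capacity `→ ∞` and landing at backward capacity `→ ∞` is invisible to
both locally-uniform driving topologies (`Lines/reversible-driving-SSgap.md`; worker W2 + lead, this seat);
its SLE(8/3)-randomisation (reversibility of SLE(8/3)) refutes the corollary as printed.  With (M), (M⁻) the
detour is excluded and the statement follows from S–S Thm. 1.2 (first statement) / Thm. 1.5 + §5 + Lemma 6.1
via "d^R + (M) ⇒ d^R_x for a dense set of interior x" (gap report `SheffieldSun-GAP.md` §2). Size XL. -/
def SheffieldSunTransfer : Prop :=
  ∀ (D : DobrushinDomain) (φ : ConformalEquiv upperHalfPlaneSet D.carrier)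
    (φ' : ConformalEquiv upperHalfPlaneSet D.swap.carrier),
    D.IsChordalUniformizing φ → D.swap.IsChordalUniformizing φ' →
    ∀ (Ωδ : ℝ → Type) [∀ δ, MeasurableSpace (Ωδ δ)] (X : (δ : ℝ) → Ωδ δ → CurveClass ℂ)
      (P : (δ : ℝ) → Measure (Ωδ δ)),
      (∀ᶠ δ : ℝ in 𝓝[>] (0 : ℝ), IsProbabilityMeasure (P δ)) →
      (∀ᶠ δ : ℝ in 𝓝[>] (0 : ℝ), AEMeasurable (X δ) (P δ)) →
      (∀ᶠ δ : ℝ in 𝓝[>] (0 : ℝ), ∀ ω : Ωδ δ,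
        X δ ω ∈ CurveClass.simple ∧
          X δ ω ∈ CurveClass.rangeSubset (D.carrier ∪ {D.pt 0, D.pt 1}) ∧
          IsLoewnerDescribable φ (X δ ω) ∧
          IsLoewnerDescribable φ' (CurveClass.reverse (X δ ω))) →
      (∀ ε : ℝ, 0 < ε → ∀ p : ℝ, 0 < p → ∃ T : ℝ≥0, ∀ᶠ δ : ℝ in 𝓝[>] (0 : ℝ),
        P δ {ω | ∃ t : ℝ≥0, T ≤ t ∧
          ε ≤ dist (φ.boundaryExtension (Loewner.trace (drivingFunction φ (X δ ω)) t)) (D.pt 1)}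
          ≤ ENNReal.ofReal p) →
      (∀ ε : ℝ, 0 < ε → ∀ p : ℝ, 0 < p → ∃ T : ℝ≥0, ∀ᶠ δ : ℝ in 𝓝[>] (0 : ℝ),
        P δ {ω | ∃ t : ℝ≥0, T ≤ t ∧
          ε ≤ dist (φ'.boundaryExtension
            (Loewner.trace (drivingFunction φ' (CurveClass.reverse (X δ ω))) t)) (D.swap.pt 1)}
          ≤ ENNReal.ofReal p) →
      TendstoLaw
        (fun δ (ω : Ωδ δ) =>
          (⟨drivingFunction φ (X δ ω), continuous_drivingFunction φ (X δ ω)⟩ : C(ℝ≥0, ℝ)))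
        P
        (fun ω : ℝ≥0 → ℝ =>
          (⟨sleDriving ((8 : ℝ≥0) / 3) ω, continuous_sleDriving ((8 : ℝ≥0) / 3) ω⟩ : C(ℝ≥0, ℝ)))
        Process.preWienerMeasure →
      TendstoLaw
        (fun δ (ω : Ωδ δ) =>
          (⟨drivingFunction φ' (CurveClass.reverse (X δ ω)),
            continuous_drivingFunction φ' (CurveClass.reverse (X δ ω))⟩ : C(ℝ≥0, ℝ)))
        P
        (fun ω : ℝ≥0 → ℝ =>
          (⟨sleDriving ((8 : ℝ≥0) / 3) ω, continuous_sleDriving ((8 : ℝ≥0) / 3) ω⟩ : C(ℝ≥0, ℝ)))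
        Process.preWienerMeasure →
      ConvergesInLawToSLE ((8 : ℝ≥0) / 3) D X P

/-- **PERTURBATION GLUE** (`= stub_lawPerturbation`): convergence in law to chordal SLE_κ along the mesh filter
passes from `X δ` to any `Y δ` with `dist (X δ) (Y δ) → 0` in probability (laws eventually probability measures,
`Y` eventually a.e.-measurable). -/
def LawPerturbation : Prop :=
  ∀ (κ : ℝ≥0) (D : DobrushinDomain) (Ωδ : ℝ → Type) [∀ δ, MeasurableSpace (Ωδ δ)]
    (X Y : (δ : ℝ) → Ωδ δ → CurveClass ℂ) (P : (δ : ℝ) → Measure (Ωδ δ)),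
    (∀ᶠ δ : ℝ in 𝓝[>] (0 : ℝ), IsProbabilityMeasure (P δ)) →
    (∀ᶠ δ : ℝ in 𝓝[>] (0 : ℝ), AEMeasurable (Y δ) (P δ)) →
    (∀ ε : ℝ, 0 < ε →
      Tendsto (fun δ : ℝ => P δ {ω | ε < dist (X δ ω) (Y δ ω)}) (𝓝[>] (0 : ℝ)) (𝓝 0)) →
    ConvergesInLawToSLE κ D X P → ConvergesInLawToSLE κ D Y P

/-- **NO LATE EXCURSION FROM THE TARGET** (`= stub_noLateReturn`, r4: the b-clause of `NoLateReturn` alone).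
For every Dobrushin domain, hexagonal endpoint approximation and `ε, p > 0` there is `η > 0` such that for all small
meshes, with `hexSAWLaw`-probability `≥ 1 - p`, the SAW polyline does not visit the closed `η`-neighbourhood of the
target `b` and AFTERWARDS a point at distance `≥ ε` from `b`.  The source clause follows for free by exact
reversibility (`noLateReturn_of_noLateExcursion`, landed).  A boundary three-arm estimate at the marked point for
the two-pinned critical SAW — research-grade (report `NoLateReturn-REPORT.md`). -/
def NoLateExcursion : Prop :=
  ∀ (D : DobrushinDomain) (a b : ℝ → HexVertex), IsEmbEndpointApprox hexGraph hexCenter D a b →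
    ∀ ε : ℝ, 0 < ε → ∀ p : ℝ, 0 < p → ∃ η : ℝ, 0 < η ∧ ∀ᶠ δ : ℝ in 𝓝[>] (0 : ℝ),
      hexSAWLaw D.carrier δ (a δ) (b δ)
          {γ | ∃ s t : unitInterval, s ≤ t ∧
            dist ((γ.walk.toCurve fun v => (δ : ℂ) * hexCenter v) s) (D.pt 1) ≤ η ∧
            ε ≤ dist ((γ.walk.toCurve fun v => (δ : ℂ) * hexCenter v) t) (D.pt 1)}
        ≤ ENNReal.ofReal p

/-- **NO LATE RETURN TO THE MARKED POINTS** (two-clause form, r3; since r4 DERIVED from `NoLateExcursion`, §4b; a LATTICE estimate, the price of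
the repaired transfer).  For every Dobrushin domain and hexagonal endpoint approximation and every `ε, p > 0`
there is `η > 0` such that, for all small meshes, with `hexSAWLaw`-probability `≥ 1 - p`: (b-clause) the SAW
polyline does not visit the closed `η`-neighbourhood of `b` and AFTERWARDS a point at distance `≥ ε` from `b`
(no late excursion from the target); (a-clause) it does not visit a point at distance `≥ ε` from `a` and
AFTERWARDS the closed `η`-neighbourhood of `a` (no late return to the source).  By exact reversibility the
a-clause for `(D; a_δ → b_δ)` is the b-clause for the reversed family `(D.swap; b_δ → a_δ)`; both are kept in
one stub for simplicity.  Heuristically a boundary three-arm event at a marked point (SLE(8/3) exponent gap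
`33/8 - 5/8`); an a-priori estimate of the two-pinned kind — see the r3 note in the header. -/
def NoLateReturn : Prop :=
  ∀ (D : DobrushinDomain) (a b : ℝ → HexVertex), IsEmbEndpointApprox hexGraph hexCenter D a b →
    ∀ ε : ℝ, 0 < ε → ∀ p : ℝ, 0 < p → ∃ η : ℝ, 0 < η ∧ ∀ᶠ δ : ℝ in 𝓝[>] (0 : ℝ),
      hexSAWLaw D.carrier δ (a δ) (b δ)
          {γ | ∃ s t : unitInterval, s ≤ t ∧
            dist ((γ.walk.toCurve fun v => (δ : ℂ) * hexCenter v) s) (D.pt 1) ≤ η ∧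
            ε ≤ dist ((γ.walk.toCurve fun v => (δ : ℂ) * hexCenter v) t) (D.pt 1)}
        ≤ ENNReal.ofReal p ∧
      hexSAWLaw D.carrier δ (a δ) (b δ)
          {γ | ∃ s t : unitInterval, s ≤ t ∧
            ε ≤ dist ((γ.walk.toCurve fun v => (δ : ℂ) * hexCenter v) s) (D.pt 0) ∧
            dist ((γ.walk.toCurve fun v => (δ : ℂ) * hexCenter v) t) (D.pt 0) ≤ η}
        ≤ ENNReal.ofReal p

/-- **TARGET TAILS FROM NO LATE RETURN** (`= stub_targetTails`, r3; deterministic/measure glue, PROVABLE).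
For a straightening `c` of the SAW classes which is `o(1)`-close in probability (clause (i) of
`TwoSidedDriving`) and eventually surely simple, boundary-avoiding and describable both ways (clause (ii)),
`NoLateReturn` for `(D; a, b)` gives the uniform target approach (M) of the capacity-parametrised straightened
curve towards `b` and (M⁻) of its reversal towards `a`: a hull at distance `≥ r` from the target has half-plane
capacity `≤ C(r, φ)` (the pull-back of `D ∖ B(b, r)` is bounded, `tendsto_boundaryExtension_cocompact`), so
after capacity `T > C(r)` the curve has visited `B̄(b, r)`; a later point at distance `≥ ε` from `b` is, up to
the `o(1)` reparametrised distance to the polyline (`Curve.exists_dist_reparam_lt`), a late excursion of the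
polyline. -/
def TargetTails : Prop :=
  ∀ (D : DobrushinDomain) (a b : ℝ → HexVertex), IsEmbEndpointApprox hexGraph hexCenter D a b →
    ∀ (φ : ConformalEquiv upperHalfPlaneSet D.carrier) (φ' : ConformalEquiv upperHalfPlaneSet D.swap.carrier),
      D.IsChordalUniformizing φ → D.swap.IsChordalUniformizing φ' →
      ∀ c : (δ : ℝ) → HexDomainSAW D.carrier δ (a δ) (b δ) → CurveClass ℂ,
        (∀ ε : ℝ, 0 < ε →
          Tendsto (fun δ : ℝ => hexSAWLaw D.carrier δ (a δ) (b δ) {γ | ε < dist (c δ γ) γ.curve})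
            (𝓝[>] (0 : ℝ)) (𝓝 0)) →
        (∀ᶠ δ : ℝ in 𝓝[>] (0 : ℝ), ∀ γ : HexDomainSAW D.carrier δ (a δ) (b δ),
          c δ γ ∈ CurveClass.simple ∧
            c δ γ ∈ CurveClass.rangeSubset (D.carrier ∪ {D.pt 0, D.pt 1}) ∧
            IsLoewnerDescribable φ (c δ γ) ∧
            IsLoewnerDescribable φ' (CurveClass.reverse (c δ γ))) →
        (∀ ε : ℝ, 0 < ε → ∀ p : ℝ, 0 < p → ∃ η : ℝ, 0 < η ∧ ∀ᶠ δ : ℝ in 𝓝[>] (0 : ℝ),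
          hexSAWLaw D.carrier δ (a δ) (b δ)
              {γ | ∃ s t : unitInterval, s ≤ t ∧
                dist ((γ.walk.toCurve fun v => (δ : ℂ) * hexCenter v) s) (D.pt 1) ≤ η ∧
                ε ≤ dist ((γ.walk.toCurve fun v => (δ : ℂ) * hexCenter v) t) (D.pt 1)}
            ≤ ENNReal.ofReal p ∧
          hexSAWLaw D.carrier δ (a δ) (b δ)
              {γ | ∃ s t : unitInterval, s ≤ t ∧
                ε ≤ dist ((γ.walk.toCurve fun v => (δ : ℂ) * hexCenter v) s) (D.pt 0) ∧
                dist ((γ.walk.toCurve fun v => (δ : ℂ) * hexCenter v) t) (D.pt 0) ≤ η}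
            ≤ ENNReal.ofReal p) →
        (∀ ε : ℝ, 0 < ε → ∀ p : ℝ, 0 < p → ∃ T : ℝ≥0, ∀ᶠ δ : ℝ in 𝓝[>] (0 : ℝ),
          hexSAWLaw D.carrier δ (a δ) (b δ) {γ | ∃ t : ℝ≥0, T ≤ t ∧
            ε ≤ dist (φ.boundaryExtension (Loewner.trace (drivingFunction φ (c δ γ)) t)) (D.pt 1)}
            ≤ ENNReal.ofReal p) ∧
        (∀ ε : ℝ, 0 < ε → ∀ p : ℝ, 0 < p → ∃ T : ℝ≥0, ∀ᶠ δ : ℝ in 𝓝[>] (0 : ℝ),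
          hexSAWLaw D.carrier δ (a δ) (b δ) {γ | ∃ t : ℝ≥0, T ≤ t ∧
            ε ≤ dist (φ'.boundaryExtension
              (Loewner.trace (drivingFunction φ' (CurveClass.reverse (c δ γ))) t)) (D.swap.pt 1)}
            ≤ ENNReal.ofReal p)

/-! ## Registered stubs — signatures INLINE over tree declarations -/

/-- **stub 1 — TWO-SIDED DRIVING CONVERGENCE** (`= TwoSidedDriving`; RESEARCH; the hardest stub; XL).
Natural supplier: an observable recipe (DCS Conjecture 2 in Carathéodory-uniform form ⇒ driving convergence by the
LSW04 LERW §3 / Schramm–Sheffield scheme, which uses the deterministic Loewner increment lemma and the martingale,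
no crossing bound), run once on `(D; a, b)` and once on `(D; b, a)` with a reversal-equivariant straightening
(`backward_iff_forward_reversed`). -/
theorem stub_twoSidedDriving :
    ∀ (D : DobrushinDomain) (a b : ℝ → HexVertex), IsEmbEndpointApprox hexGraph hexCenter D a b →
    ∀ (φ : ConformalEquiv upperHalfPlaneSet D.carrier) (φ' : ConformalEquiv upperHalfPlaneSet D.swap.carrier),
      D.IsChordalUniformizing φ → D.swap.IsChordalUniformizing φ' →
      ∃ c : (δ : ℝ) → HexDomainSAW D.carrier δ (a δ) (b δ) → CurveClass ℂ,
        (∀ ε : ℝ, 0 < ε →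
          Tendsto (fun δ : ℝ => hexSAWLaw D.carrier δ (a δ) (b δ) {γ | ε < dist (c δ γ) γ.curve})
            (𝓝[>] (0 : ℝ)) (𝓝 0)) ∧
        (∀ᶠ δ : ℝ in 𝓝[>] (0 : ℝ), ∀ γ : HexDomainSAW D.carrier δ (a δ) (b δ),
          c δ γ ∈ CurveClass.simple ∧
            c δ γ ∈ CurveClass.rangeSubset (D.carrier ∪ {D.pt 0, D.pt 1}) ∧
            IsLoewnerDescribable φ (c δ γ) ∧
            IsLoewnerDescribable φ' (CurveClass.reverse (c δ γ))) ∧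
        TendstoLaw
          (fun δ (γ : HexDomainSAW D.carrier δ (a δ) (b δ)) =>
            (⟨drivingFunction φ (c δ γ), continuous_drivingFunction φ (c δ γ)⟩ : C(ℝ≥0, ℝ)))
          (fun δ => hexSAWLaw D.carrier δ (a δ) (b δ))
          (fun ω : ℝ≥0 → ℝ =>
            (⟨sleDriving ((8 : ℝ≥0) / 3) ω, continuous_sleDriving ((8 : ℝ≥0) / 3) ω⟩ : C(ℝ≥0, ℝ)))
          Process.preWienerMeasure ∧
        TendstoLaw
          (fun δ (γ : HexDomainSAW D.carrier δ (a δ) (b δ)) =>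
            (⟨drivingFunction φ' (CurveClass.reverse (c δ γ)),
              continuous_drivingFunction φ' (CurveClass.reverse (c δ γ))⟩ : C(ℝ≥0, ℝ)))
          (fun δ => hexSAWLaw D.carrier δ (a δ) (b δ))
          (fun ω : ℝ≥0 → ℝ =>
            (⟨sleDriving ((8 : ℝ≥0) / 3) ω, continuous_sleDriving ((8 : ℝ≥0) / 3) ω⟩ : C(ℝ≥0, ℝ)))
          Process.preWienerMeasure := by
  sorry

/-- **stub 2 — SHEFFIELD–SUN TRANSFER** (`= SheffieldSunTransfer`; PUBLISHED THEOREM: S. Sheffield, N. Sun,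
Ann. Probab. 40 (2012) 578–610, arXiv:1003.4675, Cor. 1.7 with `κ = 8/3 ≤ 4`; existence of the SLE(8/3) curve in
`(D; a, b)` from Rohde–Schramm, in the tree `exists_isSLECurve_at`, `hasSLETrace_of_ne_eight_holds`). Size XL
(formalisation) — or re-file as a Literature named fact and re-type `HexTight_of` with `(h : Fact) →`. -/
theorem stub_sheffieldSun :
    ∀ (D : DobrushinDomain) (φ : ConformalEquiv upperHalfPlaneSet D.carrier)
    (φ' : ConformalEquiv upperHalfPlaneSet D.swap.carrier),
    D.IsChordalUniformizing φ → D.swap.IsChordalUniformizing φ' →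
    ∀ (Ωδ : ℝ → Type) [∀ δ, MeasurableSpace (Ωδ δ)] (X : (δ : ℝ) → Ωδ δ → CurveClass ℂ)
      (P : (δ : ℝ) → Measure (Ωδ δ)),
      (∀ᶠ δ : ℝ in 𝓝[>] (0 : ℝ), IsProbabilityMeasure (P δ)) →
      (∀ᶠ δ : ℝ in 𝓝[>] (0 : ℝ), AEMeasurable (X δ) (P δ)) →
      (∀ᶠ δ : ℝ in 𝓝[>] (0 : ℝ), ∀ ω : Ωδ δ,
        X δ ω ∈ CurveClass.simple ∧
          X δ ω ∈ CurveClass.rangeSubset (D.carrier ∪ {D.pt 0, D.pt 1}) ∧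
          IsLoewnerDescribable φ (X δ ω) ∧
          IsLoewnerDescribable φ' (CurveClass.reverse (X δ ω))) →
      (∀ ε : ℝ, 0 < ε → ∀ p : ℝ, 0 < p → ∃ T : ℝ≥0, ∀ᶠ δ : ℝ in 𝓝[>] (0 : ℝ),
        P δ {ω | ∃ t : ℝ≥0, T ≤ t ∧
          ε ≤ dist (φ.boundaryExtension (Loewner.trace (drivingFunction φ (X δ ω)) t)) (D.pt 1)}
          ≤ ENNReal.ofReal p) →
      (∀ ε : ℝ, 0 < ε → ∀ p : ℝ, 0 < p → ∃ T : ℝ≥0, ∀ᶠ δ : ℝ in 𝓝[>] (0 : ℝ),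
        P δ {ω | ∃ t : ℝ≥0, T ≤ t ∧
          ε ≤ dist (φ'.boundaryExtension
            (Loewner.trace (drivingFunction φ' (CurveClass.reverse (X δ ω))) t)) (D.swap.pt 1)}
          ≤ ENNReal.ofReal p) →
      TendstoLaw
        (fun δ (ω : Ωδ δ) =>
          (⟨drivingFunction φ (X δ ω), continuous_drivingFunction φ (X δ ω)⟩ : C(ℝ≥0, ℝ)))
        P
        (fun ω : ℝ≥0 → ℝ =>
          (⟨sleDriving ((8 : ℝ≥0) / 3) ω, continuous_sleDriving ((8 : ℝ≥0) / 3) ω⟩ : C(ℝ≥0, ℝ)))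
        Process.preWienerMeasure →
      TendstoLaw
        (fun δ (ω : Ωδ δ) =>
          (⟨drivingFunction φ' (CurveClass.reverse (X δ ω)),
            continuous_drivingFunction φ' (CurveClass.reverse (X δ ω))⟩ : C(ℝ≥0, ℝ)))
        P
        (fun ω : ℝ≥0 → ℝ =>
          (⟨sleDriving ((8 : ℝ≥0) / 3) ω, continuous_sleDriving ((8 : ℝ≥0) / 3) ω⟩ : C(ℝ≥0, ℝ)))
        Process.preWienerMeasure →
      ConvergesInLawToSLE ((8 : ℝ≥0) / 3) D X P := by
  sorry

/-- **stub 3 — PERTURBATION GLUE** (`= LawPerturbation`): LANDED, p137815,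
`Theorems/SAWDevelopingMapHexTightLawPerturbation.lean`,
`Summit.CriticalPhenomena.SAWScalingLimit.Theorems.HexTight.ReversibleDriving.stub_lawPerturbation` (imported; used
by name in `HexTight_skeleton`). -/
example : LawPerturbation :=
  Summit.CriticalPhenomena.SAWScalingLimit.Theorems.HexTight.ReversibleDriving.stub_lawPerturbation

/-- **stub 4 — NO LATE EXCURSION FROM THE TARGET** (`= NoLateExcursion`; LATTICE ESTIMATE, research-grade:
a boundary three-arm bound at the marked point for the two-pinned critical SAW; numerically unproblematic,
no tool known — the honest price of the repaired Sheffield–Sun transfer; the source clause is free by exact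
reversibility). -/
theorem stub_noLateReturn :
  ∀ (D : DobrushinDomain) (a b : ℝ → HexVertex), IsEmbEndpointApprox hexGraph hexCenter D a b →
    ∀ ε : ℝ, 0 < ε → ∀ p : ℝ, 0 < p → ∃ η : ℝ, 0 < η ∧ ∀ᶠ δ : ℝ in 𝓝[>] (0 : ℝ),
      hexSAWLaw D.carrier δ (a δ) (b δ)
          {γ | ∃ s t : unitInterval, s ≤ t ∧
            dist ((γ.walk.toCurve fun v => (δ : ℂ) * hexCenter v) s) (D.pt 1) ≤ η ∧
            ε ≤ dist ((γ.walk.toCurve fun v => (δ : ℂ) * hexCenter v) t) (D.pt 1)}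
        ≤ ENNReal.ofReal p := by
  sorry

/-! ## §4b Exact reversibility again: the source clause is the target clause of the reversed family
(kernel-checked copy of the LANDED glue `Theorems/SAWDevelopingMapHexTightNoLateReturnReduction.lean`, p140037, W4;
kept inline because that module imports `HexConjecture/Negative/Reversal.lean`, see the r4 header note) -/

namespace NoLateReturnReduction

/-! ## §1 Reversing a vertex list reverses the order of visits of its polyline -/

section Polyline

open Literature.Probability.Percolation

variable {E : Type*} [NormedAddCommGroup E] [NormedSpace ℝ E]

/-- `dyadicTime n` maps `[0, 1]` into `[0, n]`. [folklore] -/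
theorem dyadicTime_mem_Icc (n : ℕ) (s : I) : dyadicTime n s ∈ Icc (0 : ℝ) n := by
  refine ⟨dyadicTime_nonneg n s.2.1, ?_⟩
  have h := monotone_dyadicTime n s.2.2
  rwa [dyadicTime_apply_one] at h

/-- `dyadicTime n` maps `[0, 1]` ONTO `[0, n]` (intermediate value theorem). [folklore] -/
theorem exists_dyadicTime_eq (n : ℕ) {u : ℝ} (hu : u ∈ Icc (0 : ℝ) n) :
    ∃ s : I, dyadicTime n s = u := by
  have h := intermediate_value_Icc (zero_le_one (α := ℝ)) (continuous_dyadicTime n).continuousOn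
  rw [dyadicTime_apply_zero, dyadicTime_apply_one] at h
  obtain ⟨s, hs, hsu⟩ := h hu
  exact ⟨⟨s, hs⟩, hsu⟩

/-- The polyline through the reversed list, evaluated at time `s`, is the affine interpolation of the
original list at parameter `n - dyadicTime n s`. [folklore] -/
theorem polyline_reverse_apply (a : E) (l : List E) (s : I) :
    LatticeModels.polyline (a :: l).reverse s =
      Percolation.affineInterp (a :: l) ((l.length : ℝ) - dyadicTime l.length s) := by
  obtain ⟨a', l', h'⟩ := List.exists_cons_of_ne_nil (List.reverse_ne_nil_iff.2 (List.cons_ne_nil a l))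
  have hlen : l'.length = l.length := by
    have := congrArg List.length h'
    simp only [List.length_reverse, List.length_cons] at this
    omega
  rw [h', polyline_cons_apply, hlen, ← h', Percolation.affineInterp_reverse a l (dyadicTime_mem_Icc _ _)]

/-- One direction of `exists_le_polyline_reverse_iff`: if the polyline through `l.reverse` visits `A` and
later `B`, then the polyline through `l` visits `B` and later `A`. [folklore] -/
theorem exists_le_polyline_of_reverse (l : List E) {A B : Set E}
    (h : ∃ s t : I, s ≤ t ∧ LatticeModels.polyline l.reverse s ∈ A ∧
      LatticeModels.polyline l.reverse t ∈ B) :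
    ∃ s t : I, s ≤ t ∧ LatticeModels.polyline l s ∈ B ∧ LatticeModels.polyline l t ∈ A := by
  obtain ⟨s, t, hst, hA, hB⟩ := h
  rcases eq_or_ne l [] with rfl | hl
  · simp only [List.reverse_nil, LatticeModels.polyline_nil, ContinuousMap.const_apply] at hA hB
    exact ⟨0, 0, le_rfl, by simpa using hB, by simpa using hA⟩
  obtain ⟨a, l, rfl⟩ := List.exists_cons_of_ne_nil hl
  set n : ℕ := l.length with hn
  rw [polyline_reverse_apply] at hA hB
  -- parameters of the two visits along the ORIGINAL interpolation, in the right order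
  set u : ℝ := (n : ℝ) - dyadicTime n s with hu
  set v : ℝ := (n : ℝ) - dyadicTime n t with hv
  have hsI := dyadicTime_mem_Icc n s
  have htI := dyadicTime_mem_Icc n t
  have hvu : v ≤ u := by
    have := monotone_dyadicTime n (show (s : ℝ) ≤ t from hst)
    simp only [hu, hv]; linarith
  have huI : u ∈ Icc (0 : ℝ) n := ⟨by simp only [hu]; linarith [hsI.2], by simp only [hu]; linarith [hsI.1]⟩
  have hvI : v ∈ Icc (0 : ℝ) n := ⟨by simp only [hv]; linarith [htI.2], by simp only [hv]; linarith [htI.1]⟩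
  obtain ⟨s', hs'⟩ := exists_dyadicTime_eq n hvI
  obtain ⟨t', ht'⟩ := exists_dyadicTime_eq n huI
  rcases le_or_gt s' t' with hle | hlt
  · refine ⟨s', t', hle, ?_, ?_⟩
    · rw [polyline_cons_apply, hs']; exact hB
    · rw [polyline_cons_apply, ht']; exact hA
  · -- `t' < s'` forces `u = v`: both visits happen at the same parameter
    have huv : u = v := by
      have := monotone_dyadicTime n (show (t' : ℝ) ≤ s' from hlt.le)
      rw [hs', ht'] at this
      exact le_antisymm this hvu
    refine ⟨s', s', le_rfl, ?_, ?_⟩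
    · rw [polyline_cons_apply, hs']; exact hB
    · rw [polyline_cons_apply, hs', ← huv]; exact hA

/-- **Reversing the vertex list reverses the order of visits**: the polyline through `l.reverse` visits
`A` and later `B` iff the polyline through `l` visits `B` and later `A`. [folklore] -/
theorem exists_le_polyline_reverse_iff (l : List E) {A B : Set E} :
    (∃ s t : I, s ≤ t ∧ LatticeModels.polyline l.reverse s ∈ A ∧
        LatticeModels.polyline l.reverse t ∈ B) ↔
      ∃ s t : I, s ≤ t ∧ LatticeModels.polyline l s ∈ B ∧ LatticeModels.polyline l t ∈ A :=
  ⟨exists_le_polyline_of_reverse l, fun h =>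
    exists_le_polyline_of_reverse l.reverse (by rwa [List.reverse_reverse])⟩

end Polyline

/-! ## §2 Walk level and law level (time reversal `sawReverse` of §0) -/

section Walk

variable {V : Type*} {G : SimpleGraph V} {emb : V → ℂ} {Ω : Set ℂ} {δ : ℝ} {a b : V}

/-- **Reversing the walk reverses the order in which its polyline visits two sets.** [folklore] -/
theorem exists_le_toCurve_sawReverse_iff (f : V → ℂ) (γ : EmbDomainSAW G emb Ω δ a b) {A B : Set ℂ} :
    (∃ s t : I, s ≤ t ∧ (sawReverse γ).walk.toCurve f s ∈ A ∧ (sawReverse γ).walk.toCurve f t ∈ B) ↔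
      ∃ s t : I, s ≤ t ∧ γ.walk.toCurve f s ∈ B ∧ γ.walk.toCurve f t ∈ A := by
  simp only [SimpleGraph.Walk.toCurve, walk_sawReverse, SimpleGraph.Walk.support_reverse, List.map_reverse]
  exact exists_le_polyline_reverse_iff _

end Walk

/-- **"`ε`-far from `c`, then `η`-close to `c`" under `P^{(u,v)}_δ` has the same mass as "`η`-close to `c`, then
`ε`-far from `c`" under `P^{(v,u)}_δ`** — every mesh, every pair of endpoints, junk cases included
(`hexSAWLaw Ω δ u v = (hexSAWLaw Ω δ v u).map sawReverse`). [folklore] -/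
theorem hexSAWLaw_farThenNear_eq_nearThenFar (Ω : Set ℂ) (δ : ℝ) (u v : HexVertex) (c : ℂ) (ε η : ℝ) :
    hexSAWLaw Ω δ u v
        {γ | ∃ s t : unitInterval, s ≤ t ∧
          ε ≤ dist ((γ.walk.toCurve fun w => (δ : ℂ) * hexCenter w) s) c ∧
          dist ((γ.walk.toCurve fun w => (δ : ℂ) * hexCenter w) t) c ≤ η} =
      hexSAWLaw Ω δ v u
        {γ | ∃ s t : unitInterval, s ≤ t ∧
          dist ((γ.walk.toCurve fun w => (δ : ℂ) * hexCenter w) s) c ≤ η ∧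
          ε ≤ dist ((γ.walk.toCurve fun w => (δ : ℂ) * hexCenter w) t) c} := by
  rw [hexSAWLaw_swap Ω δ v u,
    Measure.map_apply (EmbDomainSAW.measurable_of_top _) MeasurableSpace.measurableSet_top]
  congr 1
  ext γ
  simp only [Set.mem_preimage, Set.mem_setOf_eq]
  exact exists_le_toCurve_sawReverse_iff (A := {z | ε ≤ dist z c}) (B := {z | dist z c ≤ η}) _ γ

end NoLateReturnReduction

open NoLateReturnReduction in
/-- **`NoLateReturn` (two clauses) follows from `NoLateExcursion`** (the b-clause, for every Dobrushin domain and every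
hexagonal endpoint approximation): apply it to `(D; a, b)` for the b-clause and to the reversed family on `D.swap`
(`isEmbEndpointApprox_swap`, `hexSAWLaw_farThenNear_eq_nearThenFar`, `pt_swap_one`) for the a-clause; `η := min η₁ η₂`.
(= landed `noLateReturn_of_noLateExcursion`, p140037.) [folklore] -/
theorem noLateReturn_of_noLateExcursion : NoLateExcursion → NoLateReturn := by
  intro h D a b hab ε hε p hp
  obtain ⟨η₁, hη₁, h₁⟩ := h D a b hab ε hε p hp
  obtain ⟨η₂, hη₂, h₂⟩ := h D.swap b a (isEmbEndpointApprox_swap hab) ε hε p hp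
  refine ⟨min η₁ η₂, lt_min hη₁ hη₂, ?_⟩
  filter_upwards [h₁, h₂] with δ hδ₁ hδ₂
  constructor
  · refine le_trans (measure_mono ?_) hδ₁
    rintro γ ⟨s, t, hst, hs, ht⟩
    exact ⟨s, t, hst, hs.trans (min_le_left _ _), ht⟩
  · rw [hexSAWLaw_farThenNear_eq_nearThenFar]
    rw [MarkedDomain.pt_swap_one] at hδ₂
    refine le_trans (measure_mono ?_) hδ₂
    rintro γ ⟨s, t, hst, hs, ht⟩
    exact ⟨s, t, hst, hs.trans (min_le_right _ _), ht⟩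


/-- The two-clause no-late-return statement from the registered stub 4. -/
theorem noLateReturn_of_stub : NoLateReturn :=
  noLateReturn_of_noLateExcursion stub_noLateReturn

/-- **stub 5 — TARGET TAILS FROM NO LATE RETURN** (`= TargetTails`): LANDED, p139515,
`Theorems/SAWDevelopingMapHexTightTargetTails.lean` (imported; used by name in `HexTight_skeleton`). -/
example : TargetTails :=
  Summit.CriticalPhenomena.SAWScalingLimit.Theorems.HexTight.ReversibleDriving.stub_targetTails

/-! ## Exact reversibility is load-bearing (sorry-free anchor)

The backward half (iv) of `TwoSidedDriving` for the family `(D; a_δ → b_δ)` with straightening `c` is LITERALLY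
the forward-type statement for the reversed walk family `(D; b_δ → a_δ)` with the straightening
`γ' ↦ reverse (c δ (sawReverse γ'))`, because `hexSAWLaw Ω δ b a = (hexSAWLaw Ω δ a b).map sawReverse`
(`Reversal.hexSAWLaw_swap`) and `sawReverse` is an involution. -/

/-- Change of variables under the exact lattice reversal: integrating an observable of the walk against the
`(b → a)` law is integrating it, precomposed with `sawReverse`, against the `(a → b)` law. [folklore] -/
theorem integral_hexSAWLaw_swap_comp {Ω : Set ℂ} {δ : ℝ} {u v : HexVertex} {F : Type*}
    [NormedAddCommGroup F] [NormedSpace ℝ F] (g : HexDomainSAW Ω δ v u → F) :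
    ∫ γ, g γ ∂(hexSAWLaw Ω δ v u) = ∫ γ, g (sawReverse γ) ∂(hexSAWLaw Ω δ u v) :=
  integral_embLaw_swap hexCriticalFugacity g

/-- **Backward driving convergence ⟺ forward-type driving convergence of the reversed family.** For any
straightening `c` of the `(a_δ → b_δ)` classes and any uniformizer `φ'` of `(D; b, a)`: the backward driving paths
`W_{φ'}(reverse (c δ γ))` under `hexSAWLaw (a_δ → b_δ)` converge in law to `Z` iff the forward driving paths of
the straightening `γ' ↦ reverse (c δ (sawReverse γ'))` of the REVERSED walks converge in law to `Z` under
`hexSAWLaw (b_δ → a_δ)`. [folklore] -/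
theorem backward_iff_forward_reversed {D : DobrushinDomain} {a b : ℝ → HexVertex}
    (φ' : ConformalEquiv upperHalfPlaneSet D.swap.carrier)
    (c : (δ : ℝ) → HexDomainSAW D.carrier δ (a δ) (b δ) → CurveClass ℂ)
    {Ω' : Type*} [MeasurableSpace Ω'] (Z : Ω' → C(ℝ≥0, ℝ)) (P' : Measure Ω') :
    TendstoLaw
        (fun δ (γ : HexDomainSAW D.carrier δ (a δ) (b δ)) =>
          (⟨drivingFunction φ' (CurveClass.reverse (c δ γ)),
            continuous_drivingFunction φ' (CurveClass.reverse (c δ γ))⟩ : C(ℝ≥0, ℝ)))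
        (fun δ => hexSAWLaw D.carrier δ (a δ) (b δ)) Z P' ↔
      TendstoLaw
        (fun δ (γ' : HexDomainSAW D.carrier δ (b δ) (a δ)) =>
          (⟨drivingFunction φ' (CurveClass.reverse (c δ (sawReverse γ'))),
            continuous_drivingFunction φ' (CurveClass.reverse (c δ (sawReverse γ')))⟩ : C(ℝ≥0, ℝ)))
        (fun δ => hexSAWLaw D.carrier δ (b δ) (a δ)) Z P' := by
  unfold TendstoLaw
  refine forall_congr' fun f => ?_
  have key : ∀ δ : ℝ,
      ∫ γ', f ((⟨drivingFunction φ' (CurveClass.reverse (c δ (sawReverse γ'))),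
          continuous_drivingFunction φ' (CurveClass.reverse (c δ (sawReverse γ')))⟩ : C(ℝ≥0, ℝ)))
        ∂(hexSAWLaw D.carrier δ (b δ) (a δ)) =
      ∫ γ, f ((⟨drivingFunction φ' (CurveClass.reverse (c δ γ)),
          continuous_drivingFunction φ' (CurveClass.reverse (c δ γ))⟩ : C(ℝ≥0, ℝ)))
        ∂(hexSAWLaw D.carrier δ (a δ) (b δ)) := by
    intro δ
    rw [integral_hexSAWLaw_swap_comp]
    simp only [sawReverse_sawReverse]
  simp_rw [key]

/-- The reversed walk family is again a critical hexagonal SAW family with a legitimate endpoint approximation of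
the swapped Dobrushin domain (`Reversal.isEmbEndpointApprox_swap`): the forward-type statement it needs is an
INSTANCE of the forward half of `TwoSidedDriving` (for `D.swap`, endpoints `(b, a)`). [folklore] -/
theorem reversed_family_is_admissible {D : DobrushinDomain} {a b : ℝ → HexVertex}
    (hab : IsEmbEndpointApprox hexGraph hexCenter D a b) :
    IsEmbEndpointApprox hexGraph hexCenter D.swap b a :=
  isEmbEndpointApprox_swap hab

/-- **FORWARD PAIR** (`ForwardPair`): the same research content displayed as TWO FORWARD driving convergences of
two critical SAW families — the `(a_δ → b_δ)` walks straightened by `c` (through `φ`) and the REVERSED walks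
`(b_δ → a_δ)` (a critical SAW family of `D.swap` with a legitimate endpoint approximation,
`reversed_family_is_admissible`) straightened by `γ' ↦ reverse (c δ (sawReverse γ'))` (through `φ'`).
Equivalent to `TwoSidedDriving` by exact lattice reversibility (`twoSided_iff_forwardPair`). -/
def ForwardPair : Prop :=
  ∀ (D : DobrushinDomain) (a b : ℝ → HexVertex), IsEmbEndpointApprox hexGraph hexCenter D a b →
    ∀ (φ : ConformalEquiv upperHalfPlaneSet D.carrier) (φ' : ConformalEquiv upperHalfPlaneSet D.swap.carrier),
      D.IsChordalUniformizing φ → D.swap.IsChordalUniformizing φ' →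
      ∃ c : (δ : ℝ) → HexDomainSAW D.carrier δ (a δ) (b δ) → CurveClass ℂ,
        (∀ ε : ℝ, 0 < ε →
          Tendsto (fun δ : ℝ => hexSAWLaw D.carrier δ (a δ) (b δ) {γ | ε < dist (c δ γ) γ.curve})
            (𝓝[>] (0 : ℝ)) (𝓝 0)) ∧
        (∀ᶠ δ : ℝ in 𝓝[>] (0 : ℝ), ∀ γ : HexDomainSAW D.carrier δ (a δ) (b δ),
          c δ γ ∈ CurveClass.simple ∧
            c δ γ ∈ CurveClass.rangeSubset (D.carrier ∪ {D.pt 0, D.pt 1}) ∧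
            IsLoewnerDescribable φ (c δ γ) ∧
            IsLoewnerDescribable φ' (CurveClass.reverse (c δ γ))) ∧
        TendstoLaw
          (fun δ (γ : HexDomainSAW D.carrier δ (a δ) (b δ)) =>
            (⟨drivingFunction φ (c δ γ), continuous_drivingFunction φ (c δ γ)⟩ : C(ℝ≥0, ℝ)))
          (fun δ => hexSAWLaw D.carrier δ (a δ) (b δ))
          (fun ω : ℝ≥0 → ℝ =>
            (⟨sleDriving ((8 : ℝ≥0) / 3) ω, continuous_sleDriving ((8 : ℝ≥0) / 3) ω⟩ : C(ℝ≥0, ℝ)))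
          Process.preWienerMeasure ∧
        TendstoLaw
          (fun δ (γ' : HexDomainSAW D.carrier δ (b δ) (a δ)) =>
            (⟨drivingFunction φ' (CurveClass.reverse (c δ (sawReverse γ'))),
              continuous_drivingFunction φ' (CurveClass.reverse (c δ (sawReverse γ')))⟩ : C(ℝ≥0, ℝ)))
          (fun δ => hexSAWLaw D.carrier δ (b δ) (a δ))
          (fun ω : ℝ≥0 → ℝ =>
            (⟨sleDriving ((8 : ℝ≥0) / 3) ω, continuous_sleDriving ((8 : ℝ≥0) / 3) ω⟩ : C(ℝ≥0, ℝ)))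
          Process.preWienerMeasure

/-- **Exact reversibility at work**: the two-sided statement for one family IS the pair of forward statements
for the family and its reversal. [folklore] -/
theorem twoSided_iff_forwardPair : TwoSidedDriving ↔ ForwardPair := by
  unfold TwoSidedDriving ForwardPair
  refine forall_congr' fun D => forall_congr' fun a => forall_congr' fun b => forall_congr' fun _ => ?_
  refine forall_congr' fun φ => forall_congr' fun φ' => forall_congr' fun _ => forall_congr' fun _ => ?_
  refine exists_congr fun c => ?_
  refine and_congr_right fun _ => and_congr_right fun _ => and_congr_right fun _ => ?_
  exact backward_iff_forward_reversed φ' c _ _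

/-! ## Disprover target (r4): the printed Sheffield–Sun Prop. 1.4 in the tree's vocabulary — FALSE

Journal Prop. 1.4 (= arXiv Thm 1.2 "second statement"), on which the printed Cor. 1.8/1.7 rests, typed for ONE
sequence of simple boundary-avoiding chords described both ways, with the backward limit taken to be the reversal
of the forward limit (a special case, so refuting this refutes the printed proposition).  It is FALSE: see
`Lines/reversible-driving-SSgap.md` (detour at forward capacity `→ ∞` and backward capacity `→ ∞`).  Recorded here
as the exact statement a `cdisprove` seat should negate in `Theorems/HexTight/Negative/` (needs the driving function
`c_θ √t` of a slanted slit, or the `O(t)` asymptotics of a circular arc — neither is in the tree yet).  NOT used by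
the composition. -/

/-- **Sheffield–Sun 2012, Prop. 1.4 (journal numbering), typed — KNOWN FALSE, disprover target.** For simple
boundary-avoiding chords `X n` of `(D; a, b)` described through `φ` and, reversed, through `φ'`, and a simple chord
`η` of the same kind: if the forward driving functions of `X n` converge locally uniformly to that of `η` and the
backward driving functions of `reverse (X n)` converge locally uniformly to that of `reverse η`, then `X n → η` in
`CurveClass ℂ`. [cite: SheffieldSun2012, Prop. 1.4] -/
def SheffieldSunProp14 : Prop :=
  ∀ (D : DobrushinDomain) (φ : ConformalEquiv upperHalfPlaneSet D.carrier)
    (φ' : ConformalEquiv upperHalfPlaneSet D.swap.carrier),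
    D.IsChordalUniformizing φ → D.swap.IsChordalUniformizing φ' →
    ∀ (X : ℕ → CurveClass ℂ) (η : CurveClass ℂ),
      (∀ n, X n ∈ CurveClass.simple ∧ X n ∈ CurveClass.rangeSubset (D.carrier ∪ {D.pt 0, D.pt 1}) ∧
        IsLoewnerDescribable φ (X n) ∧ IsLoewnerDescribable φ' (CurveClass.reverse (X n))) →
      η ∈ CurveClass.simple → η ∈ CurveClass.rangeSubset (D.carrier ∪ {D.pt 0, D.pt 1}) →
      IsLoewnerDescribable φ η → IsLoewnerDescribable φ' (CurveClass.reverse η) →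
      Tendsto (fun n => (⟨drivingFunction φ (X n), continuous_drivingFunction φ (X n)⟩ : C(ℝ≥0, ℝ))) atTop
        (𝓝 (⟨drivingFunction φ η, continuous_drivingFunction φ η⟩ : C(ℝ≥0, ℝ))) →
      Tendsto (fun n => (⟨drivingFunction φ' (CurveClass.reverse (X n)),
          continuous_drivingFunction φ' (CurveClass.reverse (X n))⟩ : C(ℝ≥0, ℝ))) atTop
        (𝓝 (⟨drivingFunction φ' (CurveClass.reverse η),
          continuous_drivingFunction φ' (CurveClass.reverse η)⟩ : C(ℝ≥0, ℝ))) →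
      Tendsto X atTop (𝓝 η)

/-! ## The checked composition -/

/-- **The line concludes the crux** (`<Crux>_of`, sorry-free; every hypothesis a named stub statement):
two-sided driving convergence + no late return (lattice) + target tails (glue) + the REPAIRED Sheffield–Sun
transfer + the perturbation glue ⇒ `HexTight`, through the landed `isTightAlongMesh_of_convergesInLawToSLE`. -/
theorem HexTight_of :
    TwoSidedDriving → NoLateReturn → TargetTails → SheffieldSunTransfer → LawPerturbation →
    Summit.CriticalPhenomena.SAWScalingLimit.Theses.SAWDefectDecoherence.HexTight := by
  intro hTS hNR hTT hSS hLP D a b hab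
  -- chordal uniformizers of (D; a, b) and (D; b, a)
  obtain ⟨φ, hφ⟩ := MarkedDomain.exists_isChordalUniformizing_holds D
  obtain ⟨φ', hφ'⟩ := MarkedDomain.exists_isChordalUniformizing_holds D.swap
  -- the straightening and its two-sided driving convergence
  obtain ⟨c, hclose, hgood, hfwd, hbwd⟩ := hTS D a b hab φ φ' hφ hφ'
  -- laws are eventually probability measures; everything on the SAW space is measurable
  have hprob : ∀ᶠ δ : ℝ in 𝓝[>] (0 : ℝ), IsProbabilityMeasure (hexSAWLaw D.carrier δ (a δ) (b δ)) :=
    eventually_isProbabilityMeasure_hexSAWLaw hab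
  have hmeasX : ∀ᶠ δ : ℝ in 𝓝[>] (0 : ℝ),
      AEMeasurable (fun γ : HexDomainSAW D.carrier δ (a δ) (b δ) => c δ γ)
        (hexSAWLaw D.carrier δ (a δ) (b δ)) :=
    Eventually.of_forall fun δ => (EmbDomainSAW.measurable_of_top _).aemeasurable
  have hmeasY : ∀ᶠ δ : ℝ in 𝓝[>] (0 : ℝ),
      AEMeasurable (fun γ : HexDomainSAW D.carrier δ (a δ) (b δ) => γ.curve)
        (hexSAWLaw D.carrier δ (a δ) (b δ)) :=
    Eventually.of_forall fun δ => (EmbDomainSAW.measurable_of_top _).aemeasurable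
  -- no late return on the lattice ⇒ uniform target approach of the straightened curves, both ways
  obtain ⟨hM, hM'⟩ := hTT D a b hab φ φ' hφ hφ' c hclose hgood (hNR D a b hab)
  -- Sheffield–Sun (repaired form): the straightened classes converge in law to SLE(8/3)
  have hconv : ConvergesInLawToSLE ((8 : ℝ≥0) / 3) D
      (fun δ (γ : HexDomainSAW D.carrier δ (a δ) (b δ)) => c δ γ)
      (fun δ => hexSAWLaw D.carrier δ (a δ) (b δ)) :=
    hSS D φ φ' hφ hφ' (fun δ => HexDomainSAW D.carrier δ (a δ) (b δ)) (fun δ γ => c δ γ)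
      (fun δ => hexSAWLaw D.carrier δ (a δ) (b δ)) hprob hmeasX hgood hM hM' hfwd hbwd
  -- perturbation: so do the raw SAW classes
  have hconv' : ConvergesInLawToSLE ((8 : ℝ≥0) / 3) D
      (fun δ (γ : HexDomainSAW D.carrier δ (a δ) (b δ)) => γ.curve)
      (fun δ => hexSAWLaw D.carrier δ (a δ) (b δ)) :=
    hLP ((8 : ℝ≥0) / 3) D (fun δ => HexDomainSAW D.carrier δ (a δ) (b δ)) (fun δ γ => c δ γ)
      (fun δ γ => γ.curve) (fun δ => hexSAWLaw D.carrier δ (a δ) (b δ)) hprob hmeasY hclose hconv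
  -- landed: convergence to SLE along the mesh ⇒ tightness along the mesh (lattice window argument)
  exact isTightAlongMesh_of_convergesInLawToSLE hconv'

/-- The same, fed with the registered stubs 1, 4 (through the reversal glue §4b), 2 (the only `sorry`s of this file)
and the LANDED stubs 5, 3. -/
theorem HexTight_skeleton :
    Summit.CriticalPhenomena.SAWScalingLimit.Theses.SAWDefectDecoherence.HexTight :=
  HexTight_of stub_twoSidedDriving noLateReturn_of_stub
    Summit.CriticalPhenomena.SAWScalingLimit.Theorems.HexTight.ReversibleDriving.stub_targetTails stub_sheffieldSun
    Summit.CriticalPhenomena.SAWScalingLimit.Theorems.HexTight.ReversibleDriving.stub_lawPerturbation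

/-- The same composition from the FORWARD PAIR (two forward driving convergences: the family and its reversal),
via exact lattice reversibility (`twoSided_iff_forwardPair`). -/
theorem HexTight_of_forwardPair :
    ForwardPair → NoLateReturn → TargetTails → SheffieldSunTransfer → LawPerturbation →
    Summit.CriticalPhenomena.SAWScalingLimit.Theses.SAWDefectDecoherence.HexTight :=
  fun hFP hNR hTT hSS hLP => HexTight_of (twoSided_iff_forwardPair.2 hFP) hNR hTT hSS hLP

/-- Skeleton-checker entry points under the sibling routes' decl names (the decl is shared VERBATIM). -/
theorem HexTight_proof :
    Summit.CriticalPhenomena.SAWScalingLimit.Theses.SAWResidueField.HexTight :=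
  fun D a b hab => HexTight_skeleton D a b hab

theorem HexTight_proof_developingMap :
    Summit.CriticalPhenomena.SAWScalingLimit.Theses.SAWDevelopingMap.HexTight :=
  fun D a b hab => HexTight_skeleton D a b hab

/-! ## By-product recorded (no stub): the line proves DCS Conjecture 1 on the way

Under the three stubs the raw SAW classes converge to SLE(8/3) (`hconv'` above), i.e. the shared item
`HexConjecture` (stmt-CriticalPhenomena-0808); tightness is read off by `TightnessNecessity`. This is the point of
the line: for a reversible model with a simple limit, tightness is not an extra a-priori estimate. -/
theorem hexConjecture_of :
    TwoSidedDriving → NoLateReturn → TargetTails → SheffieldSunTransfer → LawPerturbation →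
    Summit.CriticalPhenomena.SAWScalingLimit.Theses.SAWDevelopingMap.HexConjecture := by
  intro hTS hNR hTT hSS hLP D a b hab
  obtain ⟨φ, hφ⟩ := MarkedDomain.exists_isChordalUniformizing_holds D
  obtain ⟨φ', hφ'⟩ := MarkedDomain.exists_isChordalUniformizing_holds D.swap
  obtain ⟨c, hclose, hgood, hfwd, hbwd⟩ := hTS D a b hab φ φ' hφ hφ'
  obtain ⟨hM, hM'⟩ := hTT D a b hab φ φ' hφ hφ' c hclose hgood (hNR D a b hab)
  have hprob : ∀ᶠ δ : ℝ in 𝓝[>] (0 : ℝ), IsProbabilityMeasure (hexSAWLaw D.carrier δ (a δ) (b δ)) :=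
    eventually_isProbabilityMeasure_hexSAWLaw hab
  exact hLP ((8 : ℝ≥0) / 3) D (fun δ => HexDomainSAW D.carrier δ (a δ) (b δ)) (fun δ γ => c δ γ)
    (fun δ γ => γ.curve) (fun δ => hexSAWLaw D.carrier δ (a δ) (b δ)) hprob
    (Eventually.of_forall fun δ => (EmbDomainSAW.measurable_of_top _).aemeasurable) hclose
    (hSS D φ φ' hφ hφ' (fun δ => HexDomainSAW D.carrier δ (a δ) (b δ)) (fun δ γ => c δ γ)
      (fun δ => hexSAWLaw D.carrier δ (a δ) (b δ)) hprob
      (Eventually.of_forall fun δ => (EmbDomainSAW.measurable_of_top _).aemeasurable) hgood hM hM' hfwd hbwd)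

end Summit.CriticalPhenomena.SAWScalingLimit.Cruxes.HexTight.ReversibleDriving

end
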